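import Summits.AnomalousDissipation.AnomalousDissipation.Theorems.SawtoothPulseCascadeK1LocalisedCascadeCircleCutoff
import Summits.AnomalousDissipation.AnomalousDissipation.Theorems.SawtoothPulseCascadeK1LocalisedCascadeFlatAffine
import Summits.AnomalousDissipation.AnomalousDissipation.Theorems.SawtoothPulseCascadeK1LocalisedCascadeZoneMeasure

/-!
# K1loc, line `Spectral` / thin start — helper: THE EXACT-SAWTOOTH CHIRP IS A CHARACTER ON EVERY LINEAR PIECE (S-D step, B-3b)

Helper file of the prover lane on the crux `K1LocalisedCascade` (stmt-AnomalousDissipation-19491), route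
`SawtoothPulseCascade` (S-D fibre ledger).  For an INTEGER strain `γ` the chirp of the `δ = 0` profile
`U⁰_j(t) = tri(2πN_j t)/(2πN_j)` on the fibre `n`, `g₀ = e^{−2πi λ U⁰_j}` with `λ = nγ ∈ ℤ`, is EXACTLY the character `e_{−λ}`
(times a unimodular constant) on each ascending piece and `e_{+λ}` on each descending piece of the sawtooth.  Hence
(`…CircleCutoff.norm_circleCutoff_le_of_char`) for every lattice symbol `ψ` with `ψ(±λ) = 0`:
* `norm_circleCutoff_exactChirp_le` — **`|(ψ ⋆ g₀)(t)| ≤ 2 ∫_{‖s‖ ≥ r/(2πN_j)} |k_ψ|`** whenever the phase `2πN_j t` is farther than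
  `r` from every corner `π/2 + πm` — the mid-band part of the exact chirp lives in the `r`-corner layers, up to kernel tails;
* `abs_U_sub_tri_le_of_far` — the ROUNDED profile is exponentially close to the exact one off the corners:
  `|U_j(t) − U⁰_j(t)| ≤ e^{−M²/2}/(2N_j)` when the phase is farther than `Mδ_j` from every corner (`…FlatAffine` + the odd symmetry
  `U_j = U⁰_j = 0` at the piece midpoints), so `|g(t) − g₀(t)| ≤ π|λ|e^{−M²/2}/N_j` there (`norm_twist_sub_exactChirp_le_of_far`) and
  `≤ 2` everywhere — the rounding is paid on the corner zones.
The `g₀`-dependence is through the hypothesis `hg₀ : ∀ t, g₀ ↑t = exp(−2πi λ tri(2πNt)/(2πN))` (no definitions).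
[cite: ElgindiLissMattingly2025, §1 (H_α, V_α: slope ±1 branches)] [cite: Grafakos2014, Prop. 3.1.2 (5)] [problem: turb]
-/

-- `Summit.<Summit>.<Problem>`: single-conjunct summit, the duplicate namespace segment is deliberate.
set_option linter.dupNamespace false

noncomputable section

namespace Summit.AnomalousDissipation.AnomalousDissipation.Theorems.SawtoothPulseCascade.K1Window

open MeasureTheory Set Filter Topology Function Complex
open scoped Real
open Literature.Analysis Literature.Analysis.FunctionSpaces Literature.Analysis.FluidPDE
open Literature.Analysis.FluidPDE.ShearStage
open Literature.Analysis.FluidPDE.SawtoothCascade Literature.Analysis.FluidPDE.SawtoothCascade.CascadeParams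
open Summit.AnomalousDissipation.AnomalousDissipation.Theorems.SawtoothPulseCascade.K1Flat
open Summit.AnomalousDissipation.AnomalousDissipation.Theorems.SawtoothPulseCascade.K1Start

/-! ## §1 Lifts of small circle elements -/

/-- Every `s ∈ T` has a lift `x ∈ [-½, ½)` with `‖s‖ = |x|`. [folklore] -/
theorem exists_lift_norm_eq (s : UnitAddCircle) : ∃ x : ℝ, (x : UnitAddCircle) = s ∧ ‖s‖ = |x| := by
  obtain ⟨x, hx, rfl⟩ : ∃ x : ℝ, x ∈ Ico (-(1 / 2 : ℝ)) (-(1 / 2) + 1) ∧ (x : UnitAddCircle) = s :=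
    ⟨(AddCircle.equivIco 1 (-(1 / 2)) s : ℝ), (AddCircle.equivIco 1 (-(1 / 2)) s).2,
      (AddCircle.equivIco 1 (-(1 / 2))).symm_apply_apply s⟩
  have hxabs : |x| ≤ 1 / 2 := abs_le.mpr ⟨hx.1, by linarith [hx.2]⟩
  exact ⟨x, rfl, (AddCircle.norm_coe_eq_abs_iff (1 : ℝ) one_ne_zero).mpr (by simpa using hxabs)⟩

/-! ## §2 The exact chirp is a character on each linear piece: mid-band bound off the corner layers -/

/-- The phase of the exact chirp is unimodular, inequality form: `‖exp(−2πiλu)‖ ≤ 1` for real `u`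
(equality: `Literature.NumberTheory.LFunctions.HorocycleStripFourier.norm_exp_neg_two_pi_mul`, not imported here). [folklore] -/
theorem norm_exp_chirp_le (lam : ℤ) (u : ℝ) : ‖Complex.exp (-(2 * π * I * lam * u))‖ ≤ 1 := by
  rw [show -(2 * π * I * (lam : ℂ) * (u : ℂ)) = ((-(2 * π * lam * u) : ℝ) : ℂ) * I by push_cast; ring,
    Complex.norm_exp_ofReal_mul_I]

/-- **The mid-band part of the exact-sawtooth chirp lives in the corner layers.**  Let `N ≥ 1`, `λ ∈ ℤ`, `g₀` the continuous
circle function with `g₀(t) = exp(−2πi λ·tri(2πNt)/(2πN))`, `ψ` a lattice symbol with `ψ(λ) = ψ(−λ) = 0` and kernel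
`k_ψ = Σ_{l∈S}ψ(l)e_{−l}`.  If the phase `2πNt` is farther than `r > 0` from every corner `π/2 + πm`, then
`|∫ k_ψ(s) g₀(t + s) ds| ≤ 2 ∫_{‖s‖ ≥ r/(2πN)} |k_ψ|`: on the arc of radius `r/(2πN)` around `t` the sawtooth is affine with slope
`±1`, so `g₀(t + s) = g₀(t)·e_{∓λ}(s)` there and `…CircleCutoff.norm_circleCutoff_le_of_char` applies.
[cite: ElgindiLissMattingly2025, §1 (slope ±1 branches)] -/
theorem norm_circleCutoff_exactChirp_le {N : ℕ} (hN : 0 < N) {lam : ℤ} {g₀ : UnitAddCircle → ℂ} (hg₀c : Continuous g₀)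
    (hg₀ : ∀ t : ℝ, g₀ (t : UnitAddCircle) = Complex.exp (-(2 * π * I * lam * ((tri (2 * π * N * t) / (2 * π * N) : ℝ) : ℂ))))
    {ψ : ℤ → ℂ} (S : Finset ℤ) (hψp : ψ lam = 0) (hψm : ψ (-lam) = 0) {r : ℝ} {t : ℝ}
    (hfar : ∀ m : ℤ, r < |2 * π * N * t - (π / 2 + π * m)|) :
    ‖∫ s : UnitAddCircle, (∑ l ∈ S, ψ l * fourier (-l) s) * g₀ ((t : UnitAddCircle) + s)‖ ≤
      2 * ∫ s in {s : UnitAddCircle | r / (2 * π * N) ≤ ‖s‖}, ‖∑ l ∈ S, ψ l * fourier (-l) s‖ := by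
  have hπ : 0 < π := Real.pi_pos
  have hNr : (0 : ℝ) < N := by exact_mod_cast hN
  have hc : 0 < 2 * π * (N : ℝ) := by positivity
  -- `|g₀| ≤ 1`
  have hg1 : ∀ b : UnitAddCircle, ‖g₀ b‖ ≤ 1 := by
    intro b
    obtain ⟨x, rfl, -⟩ := exists_lift_norm_eq b
    rw [hg₀]; exact norm_exp_chirp_le _ _
  -- the value of the sawtooth along the arc
  have key : ∀ (σ : ℝ) (x : ℝ), tri (2 * π * N * (t + x)) / (2 * π * N) = tri (2 * π * N * t) / (2 * π * N) + σ * x →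
      g₀ ((t : UnitAddCircle) + (x : UnitAddCircle)) =
        g₀ (t : UnitAddCircle) * Complex.exp (-(2 * π * I * lam * (((σ * x : ℝ)) : ℂ))) := by
    intro σ x hx
    rw [← AddCircle.coe_add, hg₀, hg₀, hx, ← Complex.exp_add]
    congr 1; push_cast; ring
  rcases flat_or_near_corner (2 * π * N * t) r with ⟨m, hm⟩ | ⟨k, h₁, h₂⟩ | ⟨k, h₁, h₂⟩
  · exact absurd hm (not_le.mpr (hfar m))
  · -- ascending piece `k`: `g₀(t + s) = g₀(t) e_{−λ}(s)` on the arc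
    refine norm_circleCutoff_le_of_char (S := S) (lam := -lam) hψm hg₀c hg1 (t : UnitAddCircle) fun s hs => ?_
    obtain ⟨x, rfl, hsx⟩ := exists_lift_norm_eq s
    rw [hsx] at hs
    have hx : |2 * π * N * x| < r := by
      rw [abs_mul, abs_of_pos hc]; calc 2 * π * N * |x| < 2 * π * N * (r / (2 * π * N)) := mul_lt_mul_of_pos_left hs hc
        _ = r := mul_div_cancel₀ r hc.ne'
    have hx' := abs_lt.mp hx
    have htri : tri (2 * π * N * (t + x)) / (2 * π * N) = tri (2 * π * N * t) / (2 * π * N) + 1 * x := by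
      have e1 : tri (2 * π * N * t) = 2 * π * N * t - 2 * π * k := by
        rw [← tri_periodic.sub_int_mul_eq k]
        rw [tri_eq_self (by linarith) (by linarith)]; ring
      have e2 : tri (2 * π * N * (t + x)) = 2 * π * N * (t + x) - 2 * π * k := by
        rw [← tri_periodic.sub_int_mul_eq k]
        rw [tri_eq_self (by nlinarith) (by nlinarith)]; ring
      rw [e1, e2]; field_simp; ring
    rw [key 1 x htri, fourier_coe_apply]
    congr 1; push_cast; ring_nf
  · -- descending piece `k`: `g₀(t + s) = g₀(t) e_{+λ}(s)` on the arc
    refine norm_circleCutoff_le_of_char (S := S) (lam := lam) hψp hg₀c hg1 (t : UnitAddCircle) fun s hs => ?_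
    obtain ⟨x, rfl, hsx⟩ := exists_lift_norm_eq s
    rw [hsx] at hs
    have hx : |2 * π * N * x| < r := by
      rw [abs_mul, abs_of_pos hc]; calc 2 * π * N * |x| < 2 * π * N * (r / (2 * π * N)) := mul_lt_mul_of_pos_left hs hc
        _ = r := mul_div_cancel₀ r hc.ne'
    have hx' := abs_lt.mp hx
    have htri : tri (2 * π * N * (t + x)) / (2 * π * N) = tri (2 * π * N * t) / (2 * π * N) + (-1) * x := by
      have e1 : tri (2 * π * N * t) = π - (2 * π * N * t - 2 * π * k) := by
        rw [← tri_periodic.sub_int_mul_eq k]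
        rw [tri_eq_pi_sub (by linarith) (by linarith)]; ring
      have e2 : tri (2 * π * N * (t + x)) = π - (2 * π * N * (t + x) - 2 * π * k) := by
        rw [← tri_periodic.sub_int_mul_eq k]
        rw [tri_eq_pi_sub (by nlinarith) (by nlinarith)]; ring
      rw [e1, e2]; field_simp; ring
    rw [key (-1) x htri, fourier_coe_apply]
    congr 1; push_cast; ring_nf


/-- **The arc-character lemma with a general symbol value.**  As `…CircleCutoff.norm_circleCutoff_le_of_char` but without
`ψ(λ) = 0`: if `|g| ≤ 1` and `g(y + s) = g(y)·e_λ(s)` for `‖s‖ < d`, then `|∫ k_ψ(s)g(y+s)ds − ψ(λ)·g(y)| ≤ 2∫_{‖s‖≥d}|k_ψ|`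
(`∫_T k_ψ e_λ = ψ(λ)` by orthogonality).  With `ψ(λ) = 1` this says that a LOW-PASS with plateau over `λ` reproduces a local
character up to kernel tails. [cite: Grafakos2014, Prop. 3.1.2 (5) and §3.1.3] -/
theorem norm_circleCutoff_sub_le_of_char {ψ : ℤ → ℂ} {S : Finset ℤ} (hψ : ∀ m, m ∉ S → ψ m = 0) {lam : ℤ}
    {g : UnitAddCircle → ℂ} (hg : Continuous g) (hg1 : ∀ b, ‖g b‖ ≤ 1) {d : ℝ} (y : UnitAddCircle)
    (hchar : ∀ s : UnitAddCircle, ‖s‖ < d → g (y + s) = g y * fourier lam s) :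
    ‖(∫ s : UnitAddCircle, (∑ l ∈ S, ψ l * fourier (-l) s) * g (y + s)) - ψ lam * g y‖ ≤
      2 * ∫ s in {s : UnitAddCircle | d ≤ ‖s‖}, ‖∑ l ∈ S, ψ l * fourier (-l) s‖ := by
  classical
  set k : UnitAddCircle → ℂ := fun s => ∑ l ∈ S, ψ l * fourier (-l) s with hk
  have hkc : Continuous k := continuous_finsetSum _ fun l _ => continuous_const.mul (fourier (-l)).continuous
  have hgy : Continuous fun s : UnitAddCircle => g (y + s) := hg.comp (continuous_const.add continuous_id)
  set E : Set UnitAddCircle := {s | d ≤ ‖s‖} with hE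
  have hEm : MeasurableSet E := measurableSet_le measurable_const continuous_norm.measurable
  have hI : ∀ {f : UnitAddCircle → ℂ}, Continuous f → Integrable f := fun hf =>
    hf.integrable_of_hasCompactSupport (HasCompactSupport.of_compactSpace _)
  -- orthogonality: `∫ k e_λ = ψ(λ)`
  have horth : ∫ s : UnitAddCircle, k s * fourier lam s = ψ lam := by
    have h1 : ∀ s : UnitAddCircle, k s * fourier lam s = ∑ l ∈ S, ψ l * ((fourier lam s : ℂ) * fourier (-l) s) := by
      intro s; rw [hk, Finset.sum_mul]; refine Finset.sum_congr rfl fun l _ => by ring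
    simp_rw [h1]
    have hIl : ∀ l ∈ S, Integrable (fun s : UnitAddCircle => ψ l * ((fourier lam s : ℂ) * fourier (-l) s)) volume :=
      fun l _ => (continuous_const.mul ((fourier lam).continuous.mul
        (fourier (-l)).continuous)).integrable_of_hasCompactSupport (HasCompactSupport.of_compactSpace _)
    rw [integral_finsetSum _ hIl]
    simp_rw [integral_const_mul, integral_fourier_mul_fourier_neg]
    by_cases hm : lam ∈ S
    · rw [Finset.sum_eq_single_of_mem lam hm fun l _ hl => by rw [if_neg (Ne.symm hl), mul_zero], if_pos rfl, mul_one]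
    · rw [Finset.sum_eq_zero fun l hl => by rw [if_neg (fun h : lam = l => hm (h ▸ hl)), mul_zero], hψ lam hm]
  have hIkg : Integrable (fun s : UnitAddCircle => k s * g (y + s)) volume := hI (hkc.mul hgy)
  have hIke : Integrable (fun s : UnitAddCircle => k s * fourier lam s) volume := hI (hkc.mul (fourier lam).continuous)
  have hsplit : ∫ s : UnitAddCircle, k s * g (y + s) =
      (∫ s in E, k s * g (y + s)) + ∫ s in Eᶜ, k s * g (y + s) := (integral_add_compl hEm hIkg).symm
  have hsplit' : ψ lam = (∫ s in E, k s * fourier lam s) + ∫ s in Eᶜ, k s * fourier lam s := by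
    rw [integral_add_compl hEm hIke, horth]
  have hcompl : ∫ s in Eᶜ, k s * g (y + s) = g y * ∫ s in Eᶜ, k s * fourier lam s := by
    rw [← integral_const_mul]
    refine setIntegral_congr_fun hEm.compl fun s hs => ?_
    have hs' : ‖s‖ < d := by simpa [hE] using hs
    rw [hchar s hs']; ring
  have hkey : (∫ s : UnitAddCircle, k s * g (y + s)) - ψ lam * g y =
      (∫ s in E, k s * g (y + s)) - g y * ∫ s in E, k s * fourier lam s := by
    rw [hsplit, hcompl]
    have : ∫ s in Eᶜ, k s * fourier lam s = ψ lam - ∫ s in E, k s * fourier lam s := by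
      linear_combination hsplit'.symm
    rw [this]; ring
  rw [hkey]
  have hI' : ∀ {f : UnitAddCircle → ℝ}, Continuous f → Integrable f := fun hf =>
    hf.integrable_of_hasCompactSupport (HasCompactSupport.of_compactSpace _)
  have hA : ‖∫ s in E, k s * g (y + s)‖ ≤ ∫ s in E, ‖k s‖ := by
    refine (norm_integral_le_integral_norm _).trans ?_
    refine setIntegral_mono_on (hI' (continuous_norm.comp (hkc.mul hgy))).integrableOn
      (hI' (continuous_norm.comp hkc)).integrableOn hEm fun s _ => ?_
    rw [norm_mul]
    exact mul_le_of_le_one_right (norm_nonneg _) (hg1 _)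
  have hB : ‖g y * ∫ s in E, k s * fourier lam s‖ ≤ ∫ s in E, ‖k s‖ := by
    rw [norm_mul]
    refine (mul_le_of_le_one_left (norm_nonneg _) (hg1 y)).trans ?_
    refine (norm_integral_le_integral_norm _).trans ?_
    refine setIntegral_mono_on (hI' (continuous_norm.comp (hkc.mul (fourier lam).continuous))).integrableOn
      (hI' (continuous_norm.comp hkc)).integrableOn hEm fun s _ => ?_
    have h1 : ‖(fourier lam s : ℂ)‖ = 1 := Circle.norm_coe _
    rw [norm_mul, h1, mul_one]
  calc ‖(∫ s in E, k s * g (y + s)) - g y * ∫ s in E, k s * fourier lam s‖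
      ≤ ‖∫ s in E, k s * g (y + s)‖ + ‖g y * ∫ s in E, k s * fourier lam s‖ := norm_sub_le _ _
    _ ≤ (∫ s in E, ‖k s‖) + ∫ s in E, ‖k s‖ := add_le_add hA hB
    _ = 2 * ∫ s in E, ‖k s‖ := by ring

/-- **Exact chirp, general plateau value**: for a symbol with `ψ(λ) = ψ(−λ) = c` and the phase `2πNt` farther than `r` from the
corners, `|∫ k_ψ(s) g₀(t+s) ds − c·g₀(t)| ≤ 2∫_{‖s‖ ≥ r/(2πN)} |k_ψ|` — with `c = 1` (low-pass whose plateau covers `±λ`) the cut-off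
REPRODUCES the chirp off the corner layers, with `c = 0` (mid-band) it KILLS it. [cite: ElgindiLissMattingly2025, §1 (slope ±1 branches)] -/
theorem norm_circleCutoff_exactChirp_sub_le {N : ℕ} (hN : 0 < N) {lam : ℤ} {g₀ : UnitAddCircle → ℂ} (hg₀c : Continuous g₀)
    (hg₀ : ∀ t : ℝ, g₀ (t : UnitAddCircle) = Complex.exp (-(2 * π * I * lam * ((tri (2 * π * N * t) / (2 * π * N) : ℝ) : ℂ))))
    {ψ : ℤ → ℂ} {S : Finset ℤ} (hψ : ∀ m, m ∉ S → ψ m = 0) {c : ℂ} (hψp : ψ lam = c) (hψm : ψ (-lam) = c)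
    {r : ℝ} {t : ℝ} (hfar : ∀ m : ℤ, r < |2 * π * N * t - (π / 2 + π * m)|) :
    ‖(∫ s : UnitAddCircle, (∑ l ∈ S, ψ l * fourier (-l) s) * g₀ ((t : UnitAddCircle) + s)) - c * g₀ (t : UnitAddCircle)‖ ≤
      2 * ∫ s in {s : UnitAddCircle | r / (2 * π * N) ≤ ‖s‖}, ‖∑ l ∈ S, ψ l * fourier (-l) s‖ := by
  have hπ : 0 < π := Real.pi_pos
  have hNr : (0 : ℝ) < N := by exact_mod_cast hN
  have hc : 0 < 2 * π * (N : ℝ) := by positivity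
  have hg1 : ∀ b : UnitAddCircle, ‖g₀ b‖ ≤ 1 := by
    intro b
    obtain ⟨x, rfl, -⟩ := exists_lift_norm_eq b
    rw [hg₀]; exact norm_exp_chirp_le _ _
  have key : ∀ (σ : ℝ) (x : ℝ), tri (2 * π * N * (t + x)) / (2 * π * N) = tri (2 * π * N * t) / (2 * π * N) + σ * x →
      g₀ ((t : UnitAddCircle) + (x : UnitAddCircle)) =
        g₀ (t : UnitAddCircle) * Complex.exp (-(2 * π * I * lam * (((σ * x : ℝ)) : ℂ))) := by
    intro σ x hx
    rw [← AddCircle.coe_add, hg₀, hg₀, hx, ← Complex.exp_add]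
    congr 1; push_cast; ring
  have harc : ∀ {x : ℝ}, |x| < r / (2 * π * N) → |2 * π * N * x| < r := fun {x} hs => by
    rw [abs_mul, abs_of_pos hc]
    calc 2 * π * N * |x| < 2 * π * N * (r / (2 * π * N)) := mul_lt_mul_of_pos_left hs hc
      _ = r := mul_div_cancel₀ r hc.ne'
  rcases flat_or_near_corner (2 * π * N * t) r with ⟨m, hm⟩ | ⟨k, h₁, h₂⟩ | ⟨k, h₁, h₂⟩
  · exact absurd hm (not_le.mpr (hfar m))
  · rw [← hψm]
    refine norm_circleCutoff_sub_le_of_char hψ (lam := -lam) hg₀c hg1 (t : UnitAddCircle) fun s hs => ?_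
    obtain ⟨x, rfl, hsx⟩ := exists_lift_norm_eq s
    rw [hsx] at hs
    have hx' := abs_lt.mp (harc hs)
    have htri : tri (2 * π * N * (t + x)) / (2 * π * N) = tri (2 * π * N * t) / (2 * π * N) + 1 * x := by
      have e1 : tri (2 * π * N * t) = 2 * π * N * t - 2 * π * k := by
        rw [← tri_periodic.sub_int_mul_eq k, tri_eq_self (by linarith) (by linarith)]; ring
      have e2 : tri (2 * π * N * (t + x)) = 2 * π * N * (t + x) - 2 * π * k := by
        rw [← tri_periodic.sub_int_mul_eq k, tri_eq_self (by nlinarith) (by nlinarith)]; ring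
      rw [e1, e2]; field_simp; ring
    rw [key 1 x htri, fourier_coe_apply]
    congr 1; push_cast; ring_nf
  · rw [← hψp]
    refine norm_circleCutoff_sub_le_of_char hψ (lam := lam) hg₀c hg1 (t : UnitAddCircle) fun s hs => ?_
    obtain ⟨x, rfl, hsx⟩ := exists_lift_norm_eq s
    rw [hsx] at hs
    have hx' := abs_lt.mp (harc hs)
    have htri : tri (2 * π * N * (t + x)) / (2 * π * N) = tri (2 * π * N * t) / (2 * π * N) + (-1) * x := by
      have e1 : tri (2 * π * N * t) = π - (2 * π * N * t - 2 * π * k) := by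
        rw [← tri_periodic.sub_int_mul_eq k, tri_eq_pi_sub (by linarith) (by linarith)]; ring
      have e2 : tri (2 * π * N * (t + x)) = π - (2 * π * N * (t + x) - 2 * π * k) := by
        rw [← tri_periodic.sub_int_mul_eq k, tri_eq_pi_sub (by nlinarith) (by nlinarith)]; ring
      rw [e1, e2]; field_simp; ring
    rw [key (-1) x htri, fourier_coe_apply]
    congr 1; push_cast; ring_nf

/-! ## §3 The rounded profile is exponentially close to the exact one off the corners -/

/-- `∫ tri(y)·gaussKernel δ (y) dy = 0` (odd integrand). [folklore] -/
theorem integral_tri_mul_gaussKernel (δ : ℝ) : ∫ y, tri y * gaussKernel δ y = 0 := by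
  have hodd : ∀ y, tri (-y) * gaussKernel δ (-y) = -(tri y * gaussKernel δ y) := by
    intro y
    rw [tri, tri, Real.sin_neg, Real.arcsin_neg, gaussKernel, gaussKernel, neg_sq]; ring
  have h := integral_neg_eq_self (fun y => tri y * gaussKernel δ y) volume
  simp only [hodd, integral_neg] at h
  linarith

/-- The rounded sawtooth vanishes at the midpoints of its ascending pieces: `S_δ(0) = 0`. [folklore] -/
theorem roundedSaw_zero (δ : ℝ) : roundedSaw δ 0 = 0 := by
  rw [roundedSaw]
  have h : ∀ y, tri (0 - y) * gaussKernel δ y = -(tri y * gaussKernel δ y) := by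
    intro y; rw [zero_sub, tri, tri, Real.sin_neg, Real.arcsin_neg]; ring
  simp_rw [h, integral_neg, integral_tri_mul_gaussKernel, neg_zero]

/-- … and at the midpoints of its descending pieces: `S_δ(π) = 0`. [folklore] -/
theorem roundedSaw_pi (δ : ℝ) : roundedSaw δ π = 0 := by
  rw [roundedSaw]
  have h : ∀ y, tri (π - y) * gaussKernel δ y = tri y * gaussKernel δ y := by
    intro y; rw [tri, tri, Real.sin_pi_sub]
  simp_rw [h, integral_tri_mul_gaussKernel]

variable (P : CascadeParams)

/-- The cascade profile vanishes at the piece midpoints `k/N_j` and `(2k+1)/(2N_j)`. [folklore] -/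
theorem U_midpoint_eq_zero {j : ℕ} (hN : P.N j ≠ 0) (k : ℤ) :
    P.U j (k / P.N j) = 0 ∧ P.U j ((2 * k + 1) / (2 * P.N j)) = 0 := by
  have hNr : (P.N j : ℝ) ≠ 0 := by exact_mod_cast hN
  constructor
  · rw [CascadeParams.U, show 2 * π * (P.N j : ℝ) * (k / P.N j) = 0 + k * (2 * π) by field_simp; ring,
      (roundedSaw_periodic (P.δ j)).int_mul k 0, roundedSaw_zero, zero_div]
  · rw [CascadeParams.U, show 2 * π * (P.N j : ℝ) * ((2 * k + 1) / (2 * P.N j)) = π + k * (2 * π) by field_simp; ring,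
      (roundedSaw_periodic (P.δ j)).int_mul k π, roundedSaw_pi, zero_div]

/-- **The rounded profile is exponentially close to the exact sawtooth off the corners.**  If the phase `2πN_j t` is farther
than `Mδ_j` from every corner (`M ≥ 1`, `Mδ_j < π/2`), then `|U_j(t) − tri(2πN_j t)/(2πN_j)| ≤ e^{−M²/2}/(2N_j)` (the profile is
affine up to slope error `2e^{−M²/2}` between `t` and the midpoint of its piece, where both profiles vanish).
[cite: ElgindiLissMattingly2025, §1 (slope ±1 branches)] -/
theorem abs_U_sub_tri_le_of_far (hδ₀ : 0 < P.δ₀) (hd : 0 < P.d) (hN₀ : 1 ≤ P.N₀) (hρ : 1 ≤ P.ρN) {j : ℕ} {M : ℝ} (hM : 1 ≤ M)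
    (hMδ : M * P.δ j < π / 2) {t : ℝ} (hfar : ∀ m : ℤ, M * P.δ j < |2 * π * P.N j * t - (π / 2 + π * m)|) :
    |P.U j t - tri (2 * π * P.N j * t) / (2 * π * P.N j)| ≤ Real.exp (-(M ^ 2 / 2)) / (2 * P.N j) := by
  have hπ : 0 < π := Real.pi_pos
  have hN : P.N j ≠ 0 := (N_pos P hN₀ hρ j).ne'
  have hNr : (0 : ℝ) < P.N j := by exact_mod_cast Nat.pos_of_ne_zero hN
  have hc : 0 < 2 * π * (P.N j : ℝ) := by positivity
  have hδ : 0 < P.δ j := P.δ_pos hδ₀ hd j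
  have hMδ0 : 0 < M * P.δ j := by positivity
  have hη0 : 0 ≤ 2 * Real.exp (-(M ^ 2 / 2)) := by positivity
  have hquarter : ∀ {u : ℝ} (k : ℤ), -(π / 2) + 2 * π * k + M * P.δ j < 2 * π * P.N j * u →
      2 * π * P.N j * u + M * P.δ j < π / 2 + 2 * π * k → |u - k / P.N j| ≤ 1 / (4 * P.N j) := by
    intro u k hu1 hu2
    have e : u - k / P.N j = (2 * π * P.N j * u - 2 * π * k) / (2 * π * P.N j) := by field_simp
    rw [e, abs_div, abs_of_pos hc, div_le_div_iff₀ hc (by positivity)]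
    have : |2 * π * ↑(P.N j) * u - 2 * π * ↑k| ≤ π / 2 := by rw [abs_le]; constructor <;> linarith
    nlinarith
  have hquarter' : ∀ {u : ℝ} (k : ℤ), π / 2 + 2 * π * k + M * P.δ j < 2 * π * P.N j * u →
      2 * π * P.N j * u + M * P.δ j < 3 * π / 2 + 2 * π * k → |u - (2 * k + 1) / (2 * P.N j)| ≤ 1 / (4 * P.N j) := by
    intro u k hu1 hu2
    have e : u - (2 * k + 1) / (2 * P.N j) = (2 * π * P.N j * u - (π + 2 * π * k)) / (2 * π * P.N j) := by
      field_simp; ring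
    rw [e, abs_div, abs_of_pos hc, div_le_div_iff₀ hc (by positivity)]
    have : |2 * π * ↑(P.N j) * u - (π + 2 * π * ↑k)| ≤ π / 2 := by rw [abs_le]; constructor <;> linarith
    nlinarith
  rcases flat_or_near_corner (2 * π * P.N j * t) (M * P.δ j) with ⟨m, hm⟩ | ⟨k, h₁, h₂⟩ | ⟨k, h₁, h₂⟩
  · exact absurd hm (not_le.mpr (hfar m))
  · -- ascending piece `k`, midpoint `y' = k/N` (phase `2πk`)
    set y' : ℝ := k / P.N j with hy'
    have hmid : 2 * π * (P.N j : ℝ) * y' = 2 * π * k := by rw [hy']; field_simp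
    have hUy' : P.U j y' = 0 := (U_midpoint_eq_zero P hN k).1
    have htri : tri (2 * π * P.N j * t) / (2 * π * P.N j) = t - y' := by
      rw [← tri_periodic.sub_int_mul_eq k, tri_eq_self (by linarith) (by linarith), hy']; field_simp
    -- the affine estimate between `t` and `y'` (both `Mδ`-inside the branch)
    have haff : |P.U j t - P.U j y' - (t - y')| ≤ 2 * Real.exp (-(M ^ 2 / 2)) * |t - y'| := by
      rcases le_total t y' with hty | hty
      · exact abs_U_sub_U_sub_le P hδ₀ hd hN₀ hρ hM k (a := t) (b := y') (by linarith)
          (by rw [hmid]; linarith) ⟨le_rfl, hty⟩ ⟨hty, le_rfl⟩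
      · exact abs_U_sub_U_sub_le P hδ₀ hd hN₀ hρ hM k (a := y') (b := t) (by rw [hmid]; linarith)
          (by linarith) ⟨hty, le_rfl⟩ ⟨le_rfl, hty⟩
    rw [htri, show P.U j t - (t - y') = P.U j t - P.U j y' - (t - y') by rw [hUy']; ring]
    refine haff.trans ?_
    have hq := hquarter k h₁ h₂
    rw [← hy'] at hq
    calc 2 * Real.exp (-(M ^ 2 / 2)) * |t - y'| ≤ 2 * Real.exp (-(M ^ 2 / 2)) * (1 / (4 * P.N j)) :=
          mul_le_mul_of_nonneg_left hq hη0
      _ = Real.exp (-(M ^ 2 / 2)) / (2 * P.N j) := by field_simp; ring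
  · -- descending piece `k`, midpoint `y' = (2k+1)/(2N)` (phase `π + 2πk`)
    set y' : ℝ := (2 * k + 1) / (2 * P.N j) with hy'
    have hmid : 2 * π * (P.N j : ℝ) * y' = π + 2 * π * k := by rw [hy']; field_simp; ring
    have hUy' : P.U j y' = 0 := (U_midpoint_eq_zero P hN k).2
    have htri : tri (2 * π * P.N j * t) / (2 * π * P.N j) = -(t - y') := by
      rw [← tri_periodic.sub_int_mul_eq k, tri_eq_pi_sub (by linarith) (by linarith), hy']; field_simp; ring
    have haff : |P.U j t - P.U j y' + (t - y')| ≤ 2 * Real.exp (-(M ^ 2 / 2)) * |t - y'| := by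
      rcases le_total t y' with hty | hty
      · exact abs_U_sub_U_add_le P hδ₀ hd hN₀ hρ hM k (a := t) (b := y') (by linarith)
          (by rw [hmid]; linarith) ⟨le_rfl, hty⟩ ⟨hty, le_rfl⟩
      · exact abs_U_sub_U_add_le P hδ₀ hd hN₀ hρ hM k (a := y') (b := t) (by rw [hmid]; linarith)
          (by linarith) ⟨hty, le_rfl⟩ ⟨le_rfl, hty⟩
    rw [htri, show P.U j t - -(t - y') = P.U j t - P.U j y' + (t - y') by rw [hUy']; ring]
    refine haff.trans ?_
    have hq := hquarter' k h₁ h₂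
    rw [← hy'] at hq
    calc 2 * Real.exp (-(M ^ 2 / 2)) * |t - y'| ≤ 2 * Real.exp (-(M ^ 2 / 2)) * (1 / (4 * P.N j)) :=
          mul_le_mul_of_nonneg_left hq hη0
      _ = Real.exp (-(M ^ 2 / 2)) / (2 * P.N j) := by field_simp; ring

/-- `‖e^{−2πiΛu} − e^{−2πiΛv}‖ ≤ 2π|Λ|·|u − v|` for real `Λ, u, v`. [folklore] -/
theorem norm_exp_chirp_sub_le (Λ u v : ℝ) :
    ‖Complex.exp (-(2 * π * I * Λ * u)) - Complex.exp (-(2 * π * I * Λ * v))‖ ≤ 2 * π * |Λ| * |u - v| := by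
  have h1 : Complex.exp (-(2 * π * I * Λ * u)) - Complex.exp (-(2 * π * I * Λ * v)) =
      Complex.exp (-(2 * π * I * Λ * v)) * (Complex.exp (I * ((-(2 * π * Λ * (u - v)) : ℝ) : ℂ)) - 1) := by
    rw [mul_sub, mul_one, ← Complex.exp_add]; congr 1; push_cast; ring
  rw [h1, norm_mul, show -(2 * (π : ℂ) * I * Λ * v) = ((-(2 * π * Λ * v) : ℝ) : ℂ) * I by push_cast; ring,
    Complex.norm_exp_ofReal_mul_I, one_mul]
  refine (Real.norm_exp_I_mul_ofReal_sub_one_le).trans (le_of_eq ?_)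
  rw [Real.norm_eq_abs, abs_neg, abs_mul, abs_mul, abs_mul, abs_two, abs_of_pos Real.pi_pos]

end Summit.AnomalousDissipation.AnomalousDissipation.Theorems.SawtoothPulseCascade.K1Window
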